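import Literature.Geometry.MetricEmbeddings.HeisenbergL1
import HarnessLib

/-!
# Word metric of the discrete Heisenberg group: connectivity, left-invariance, ball–box comparison
(transport lemmas toward the discharge of `CheegerKleinerNaor2011_wordBall_l1Distortion`)

Family `pnp`, layer `Literature/Geometry/MetricEmbeddings`; sibling proofs file of `HeisenbergL1.lean`
(D-0014 append protocol: the discharge `CheegerKleinerNaor2011_wordBall_l1Distortion_holds`, when it
exists, lives here). Source read: J. Cheeger, B. Kleiner, A. Naor, *Compression bounds for Lipschitz
maps from the Heisenberg group to `L₁`*, Acta Math. 207 (2011) = arXiv:0910.2026, §1.1, in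
particular the paragraph "We close this subsection by explaining how Corollaries 1.3 and 1.2 are
deduced from Theorem 1.1" (arXiv p. 6): Cor. 1.2 (`c₁({0,…,n}³, ρ) ≳ (log n)^δ`) follows from
Thm. 1.1 (quantitative central collapse) by (i) the bi-Lipschitz equivalence of the word metric with
the restriction of `d^ℍ` to the lattice ("easy general lemma … see [BBI]"), (ii) left-invariance and
the homotheties `A_R(a,b,c) = (Ra,Rb,R²c)`, (iii) a Lipschitz extension `ℍ(ℤ) → ℍ`, (iv) Thm. 1.1.

STATUS. The named fact is NOT discharged in the tree: step (iv) is the whole of [CKN] §§3–12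
(cut measures and perimeter in `ℍ`, the kinematic formula, classification and quantitative
stability of monotone sets; crude `δ = 2^{-60}`), a theory absent from Mathlib, and no elementary
proof of any `(log r)^δ` lower bound for `c₁` of `ℍ(ℤ)`-balls is known. PROVED here are the
discrete, self-contained parts of steps (i)–(ii) on the concrete carrier of `HeisenbergL1.lean`
(`heisMul`, `cayleyGraph`, `wordBall`, `d_W = cayleyGraph.dist`):

* `cayleyGraph_reachable` / `cayleyGraph_connected`: the Cayley graph is connected (`a, b` generate;
  the commutator walk `a b a⁻¹ b⁻¹` moves the centre), so `d_W` is a genuine metric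
  (`SimpleGraph.Connected.dist_triangle` …) and `mem_wordBall_iff_dist_le`: `𝔅_r` is the closed
  `d_W`-ball;
* `dist_heisMul_left`: `d_W(k·g, k·h) = d_W(g, h)` (LEFT-invariance; edges are RIGHT translates);
* one-parameter bounds `dist_mulA_le`, `dist_mulB_le` (`d_W(g, g·aᵏ), d_W(g, g·bᵏ) ≤ |k|`),
  `dist_zero_center_le` (`d_W(1, cᵗ) ≤ 2|t|+2`), `dist_zero_center_mul_le`
  (`d_W(1, c^{qn}) ≤ 2n+2|q|`, the walk `aⁿ b^q a⁻ⁿ b⁻^q`), `dist_zero_center_le_of_sq`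
  (`|w| ≤ 2n² ⇒ d_W(1, cʷ) ≤ 8n`);
* the **discrete ball–box comparison** `dist_zero_le_of_box` / `box_subset_wordBall`:
  `|x|,|y| ≤ n, |z| ≤ n² ⇒ d_W(1,(x,y,z)) ≤ 10n`, i.e. `B_n ⊆ 𝔅_{10n}`, converse to
  `mem_wordBall_bounds` (`𝔅_r ⊆ B_r`) of `HeisenbergL1.lean`: the word metric is bi-Lipschitz to
  the gauge `|x| + |y| + √|z|` (the discrete content of (i), cf. Blachère's exact formula).

Not here: steps (iii)–(iv), the cut-cone representation of `ℓ₁`-metrics, a `Group` instance.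

## References

* [CheegerKleinerNaor2011] J. Cheeger, B. Kleiner, A. Naor, Acta Math. 207 (2011) 291–373, §1.1
  (arXiv:0910.2026 pp. 4–6).
* [NaorYoung2018] A. Naor, R. Young, Ann. of Math. 188 (2018), §1.2 (word balls `𝔅_r`).
-/

noncomputable section

namespace Literature.Geometry.MetricEmbeddings

/-! ### Connectivity, left-invariance and the ball–box comparison for the word metric

Transport lemmas for the deduction of [CKN Cor. 1.2] from [CKN Thm. 1.1] (arXiv p. 6: "the word
metric `d_T` on `Γ` is the left invariant metric …", "`ℍ(ℤ)` … is a discrete cocompact subgroup of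
`ℍ`", the homotheties `A_R(a,b,c) = (Ra,Rb,R²c)`, and `{0,…,n}³` versus metric balls): the Cayley
graph is connected (so `d_W = cayleyGraph.dist` is a genuine metric and `wordBall r` is the closed
`d_W`-ball of radius `r`), `d_W` is invariant under LEFT multiplication `heisMul k` (the edges are
RIGHT multiplication by generators), the elementary one-parameter distance bounds
`d_W(g, g·aᵏ) ≤ |k|`, `d_W(g, g·bᵏ) ≤ |k|`, `d_W(g, g·cᵗ) ≤ 2|t| + 2`, `d_W(g, g·c^{qn}) ≤ 2n + 2|q|`
(`c = [a,b]` central), and, conversely to `mem_wordBall_bounds` (`𝔅_r ⊆ B_r`), the **discrete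
ball–box comparison** `B_n = {|x|,|y| ≤ n, |z| ≤ n²} ⊆ 𝔅_{10n}`. -/

/-- Adjacency to the right `a`-translate `(x,y,z)·a = (x+1, y, z)`, the new coordinate given up
to propositional equality. [cite: CheegerKleinerNaor2011, §1.1] -/
theorem cayleyGraph_adj_mk_mulA {x y z x' : ℤ} (h1 : x' = x + 1) :
    cayleyGraph.Adj (x, y, z) (x', y, z) := by
  subst h1
  rw [cayleyGraph_adj]
  refine ⟨fun e => ?_, Or.inl (Or.inl rfl)⟩
  have := congrArg Prod.fst e
  simp at this

/-- Adjacency to the right `b`-translate `(x,y,z)·b = (x, y+1, z+x)`, the new coordinates given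
up to propositional equality. [cite: CheegerKleinerNaor2011, §1.1] -/
theorem cayleyGraph_adj_mk_mulB {x y z y' z' : ℤ} (h2 : y' = y + 1) (h3 : z' = z + x) :
    cayleyGraph.Adj (x, y, z) (x, y', z') := by
  subst h2 h3
  rw [cayleyGraph_adj]
  refine ⟨fun e => ?_, Or.inl (Or.inr rfl)⟩
  have := congrArg (fun p : ℤ × ℤ × ℤ => p.2.1) e
  simp at this

/-- Equal elements are joined (by the trivial walk). [folklore] -/
private theorem reachable_of_eq {g h : ℤ × ℤ × ℤ} (e : g = h) : cayleyGraph.Reachable g h :=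
  e ▸ SimpleGraph.Reachable.refl g

/-- `g` is joined to `g·aᵏ = (x+k, y, z)`. [cite: CheegerKleinerNaor2011, §1.1] -/
private theorem reachable_mulA (x y z k : ℤ) :
    cayleyGraph.Reachable (x, y, z) (x + k, y, z) := by
  induction k using Int.induction_on with
  | zero => exact reachable_of_eq (by simp)
  | succ i ih =>
    exact ih.trans (SimpleGraph.Adj.reachable (cayleyGraph_adj_mk_mulA (by ring)))
  | pred i ih =>
    exact ih.trans
      (SimpleGraph.Adj.reachable (cayleyGraph_adj_mk_mulA (by ring))).symm

/-- `g` is joined to `g·bᵏ = (x, y+k, z+kx)`. [cite: CheegerKleinerNaor2011, §1.1] -/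
private theorem reachable_mulB (x y z k : ℤ) :
    cayleyGraph.Reachable (x, y, z) (x, y + k, z + k * x) := by
  induction k using Int.induction_on with
  | zero => exact reachable_of_eq (by simp)
  | succ i ih =>
    exact ih.trans (SimpleGraph.Adj.reachable
      (cayleyGraph_adj_mk_mulB (by ring) (by ring)))
  | pred i ih =>
    exact ih.trans (SimpleGraph.Adj.reachable
      (cayleyGraph_adj_mk_mulB (by ring) (by ring))).symm

/-- The commutator walk `a b a⁻¹ b⁻¹` joins `g` to `g·c = (x, y, z+1)`.
[cite: CheegerKleinerNaor2011, §1.1] -/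
private theorem reachable_center_succ (x y z : ℤ) :
    cayleyGraph.Reachable (x, y, z) (x, y, z + 1) := by
  have h1 : cayleyGraph.Adj (x, y, z) (x + 1, y, z) := cayleyGraph_adj_mk_mulA rfl
  have h2 : cayleyGraph.Adj (x + 1, y, z) (x + 1, y + 1, z + (x + 1)) :=
    cayleyGraph_adj_mk_mulB rfl rfl
  have h3 : cayleyGraph.Adj (x, y + 1, z + (x + 1)) (x + 1, y + 1, z + (x + 1)) :=
    cayleyGraph_adj_mk_mulA rfl
  have h4 : cayleyGraph.Adj (x, y, z + 1) (x, y + 1, z + (x + 1)) :=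
    cayleyGraph_adj_mk_mulB rfl (by ring)
  exact h1.reachable.trans (h2.reachable.trans (h3.reachable.symm.trans h4.reachable.symm))

/-- `g` is joined to `g·cᵏ = (x, y, z+k)`. [cite: CheegerKleinerNaor2011, §1.1] -/
private theorem reachable_center (x y z k : ℤ) :
    cayleyGraph.Reachable (x, y, z) (x, y, z + k) := by
  induction k using Int.induction_on with
  | zero => exact reachable_of_eq (by simp)
  | succ i ih =>
    have h := reachable_center_succ x y (z + i)
    rw [add_assoc] at h
    exact ih.trans h
  | pred i ih =>
    have h := reachable_center_succ x y (z + (-(i : ℤ) - 1))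
    rw [show z + (-(i : ℤ) - 1) + 1 = z + -(i : ℤ) by ring] at h
    exact ih.trans h.symm

/-- **The Cayley graph of `ℍ(ℤ)` is connected**: any two elements are joined by a walk (`a, b`
generate `ℍ(ℤ)`: `aˣ bʸ` reaches `(x, y, xy)` and the commutator `c = [a,b]` moves the central
coordinate). [cite: CheegerKleinerNaor2011, §1.1] -/
theorem cayleyGraph_reachable (g h : ℤ × ℤ × ℤ) : cayleyGraph.Reachable g h := by
  suffices H : ∀ g : ℤ × ℤ × ℤ, cayleyGraph.Reachable (0, 0, 0) g from (H g).symm.trans (H h)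
  rintro ⟨x, y, z⟩
  have h1 := reachable_mulA 0 0 0 x
  rw [zero_add] at h1
  have h2 := reachable_mulB x 0 0 y
  rw [zero_add, zero_add] at h2
  have h3 := reachable_center x y (y * x) (z - y * x)
  rw [show y * x + (z - y * x) = z by ring] at h3
  exact h1.trans (h2.trans h3)

/-- The Cayley graph of `ℍ(ℤ)` is preconnected. [cite: CheegerKleinerNaor2011, §1.1] -/
theorem cayleyGraph_preconnected : cayleyGraph.Preconnected := cayleyGraph_reachable

/-- The Cayley graph of `ℍ(ℤ)` is connected, so `d_W = cayleyGraph.dist` is a genuine metric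
(`SimpleGraph.Connected.dist_triangle`, `…pos_dist_of_ne`). [cite: CheegerKleinerNaor2011, §1.1] -/
theorem cayleyGraph_connected : cayleyGraph.Connected := ⟨cayleyGraph_preconnected⟩

/-- **The word ball is the closed `d_W`-ball**: `g ∈ wordBall r ↔ d_W(1, g) ≤ r`
("`𝔅_r = {h : d_W(h, 1) ≤ r}`"). [cite: NaorYoung2018, §1.2] -/
theorem mem_wordBall_iff_dist_le {r : ℕ} {g : ℤ × ℤ × ℤ} :
    g ∈ wordBall r ↔ cayleyGraph.dist (0, 0, 0) g ≤ r := by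
  constructor
  · rintro ⟨p, hp⟩
    exact (SimpleGraph.dist_le p).trans hp
  · intro h
    obtain ⟨p, hp⟩ := (cayleyGraph_reachable (0, 0, 0) g).exists_walk_length_eq_dist
    exact ⟨p, hp.le.trans h⟩

/-- Word balls are monotone in the radius. [cite: NaorYoung2018, §1.2] -/
theorem wordBall_mono {r s : ℕ} (h : r ≤ s) : wordBall r ⊆ wordBall s :=
  fun _ ⟨p, hp⟩ => ⟨p, hp.trans h⟩

/-- Left multiplication `g ↦ k·g` preserves adjacency (the edges of the Cayley graph are RIGHT
multiplications by generators, and `heisMul` is associative). [cite: CheegerKleinerNaor2011, §1.1] -/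
theorem cayleyGraph_adj_heisMul_left (k : ℤ × ℤ × ℤ) {g h : ℤ × ℤ × ℤ}
    (hgh : cayleyGraph.Adj g h) : cayleyGraph.Adj (heisMul k g) (heisMul k h) := by
  rw [cayleyGraph_adj] at hgh ⊢
  obtain ⟨hne, hrel⟩ := hgh
  obtain ⟨k1, k2, k3⟩ := k
  obtain ⟨x, y, z⟩ := g
  obtain ⟨x', y', z'⟩ := h
  simp only [heisMul, ne_eq, Prod.mk.injEq] at hrel hne ⊢
  refine ⟨?_, ?_⟩
  · rintro ⟨e1, e2, e3⟩
    apply hne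
    have e1' : x = x' := by linarith
    have e2' : y = y' := by linarith
    have e3' : z = z' := by rw [e2'] at e3; linarith
    exact ⟨e1', e2', e3'⟩
  · rcases hrel with (⟨rfl, rfl, rfl⟩ | ⟨rfl, rfl, rfl⟩) | (⟨rfl, rfl, rfl⟩ | ⟨rfl, rfl, rfl⟩)
    · exact Or.inl (Or.inl ⟨by ring, by ring, by ring⟩)
    · exact Or.inl (Or.inr ⟨by ring, by ring, by ring⟩)
    · exact Or.inr (Or.inl ⟨by ring, by ring, by ring⟩)
    · exact Or.inr (Or.inr ⟨by ring, by ring, by ring⟩)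

/-- The inverse `k⁻¹ = (-k₁, -k₂, -k₃ + k₁k₂)` undoes left multiplication by `k`.
[cite: CheegerKleinerNaor2011, §1.1] -/
theorem heisMul_inv_left (k g : ℤ × ℤ × ℤ) :
    heisMul (-k.1, -k.2.1, -k.2.2 + k.1 * k.2.1) (heisMul k g) = g := by
  obtain ⟨k1, k2, k3⟩ := k
  obtain ⟨x, y, z⟩ := g
  simp only [heisMul, Prod.mk.injEq]
  exact ⟨by ring, by ring, by ring⟩

/-- Left multiplication does not increase word distances (map a geodesic walk along the graph
homomorphism `g ↦ k·g`). [cite: CheegerKleinerNaor2011, §1.1] -/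
theorem dist_heisMul_left_le (k g h : ℤ × ℤ × ℤ) :
    cayleyGraph.dist (heisMul k g) (heisMul k h) ≤ cayleyGraph.dist g h := by
  let φ : cayleyGraph →g cayleyGraph :=
    { toFun := heisMul k, map_rel' := fun hgh => cayleyGraph_adj_heisMul_left k hgh }
  obtain ⟨p, hp⟩ := (cayleyGraph_reachable g h).exists_walk_length_eq_dist
  have hle := SimpleGraph.dist_le (p.map φ)
  rwa [SimpleGraph.Walk.length_map, hp] at hle

/-- **Left-invariance of the word metric**: `d_W(k·g, k·h) = d_W(g, h)` ("the word metric … is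
the left invariant metric …"). [cite: CheegerKleinerNaor2011, §1.1] -/
theorem dist_heisMul_left (k g h : ℤ × ℤ × ℤ) :
    cayleyGraph.dist (heisMul k g) (heisMul k h) = cayleyGraph.dist g h := by
  refine le_antisymm (dist_heisMul_left_le k g h) ?_
  have key := dist_heisMul_left_le (-k.1, -k.2.1, -k.2.2 + k.1 * k.2.1) (heisMul k g) (heisMul k h)
  rwa [heisMul_inv_left, heisMul_inv_left] at key

/-- `d_W(g, g·aᵏ) ≤ |k|`, i.e. `d_W((x,y,z), (x+k,y,z)) ≤ |k|`. [cite: CheegerKleinerNaor2011, §1.1] -/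
theorem dist_mulA_le (x y z k : ℤ) :
    cayleyGraph.dist (x, y, z) (x + k, y, z) ≤ k.natAbs := by
  induction k using Int.induction_on with
  | zero => simp
  | succ i ih =>
    have hadj : cayleyGraph.Adj (x + i, y, z) (x + (i + 1), y, z) :=
      cayleyGraph_adj_mk_mulA (by ring)
    calc cayleyGraph.dist (x, y, z) (x + (i + 1), y, z)
        ≤ cayleyGraph.dist (x, y, z) (x + i, y, z) +
            cayleyGraph.dist (x + i, y, z) (x + (i + 1), y, z) :=
          cayleyGraph_connected.dist_triangle
      _ ≤ (i : ℤ).natAbs + 1 :=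
          add_le_add ih (SimpleGraph.dist_eq_one_iff_adj.mpr hadj).le
      _ = ((i : ℤ) + 1).natAbs := by omega
  | pred i ih =>
    have hadj : cayleyGraph.Adj (x + (-(i : ℤ) - 1), y, z) (x + -(i : ℤ), y, z) :=
      cayleyGraph_adj_mk_mulA (by ring)
    calc cayleyGraph.dist (x, y, z) (x + (-(i : ℤ) - 1), y, z)
        ≤ cayleyGraph.dist (x, y, z) (x + -(i : ℤ), y, z) +
            cayleyGraph.dist (x + -(i : ℤ), y, z) (x + (-(i : ℤ) - 1), y, z) :=
          cayleyGraph_connected.dist_triangle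
      _ ≤ (-(i : ℤ)).natAbs + 1 :=
          add_le_add ih (SimpleGraph.dist_eq_one_iff_adj.mpr hadj.symm).le
      _ = (-(i : ℤ) - 1).natAbs := by omega

/-- `d_W(g, g·bᵏ) ≤ |k|`, i.e. `d_W((x,y,z), (x,y+k,z+kx)) ≤ |k|`.
[cite: CheegerKleinerNaor2011, §1.1] -/
theorem dist_mulB_le (x y z k : ℤ) :
    cayleyGraph.dist (x, y, z) (x, y + k, z + k * x) ≤ k.natAbs := by
  induction k using Int.induction_on with
  | zero => simp
  | succ i ih =>
    have hadj : cayleyGraph.Adj (x, y + i, z + i * x) (x, y + (i + 1), z + (i + 1) * x) :=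
      cayleyGraph_adj_mk_mulB (by ring) (by ring)
    calc cayleyGraph.dist (x, y, z) (x, y + (i + 1), z + (i + 1) * x)
        ≤ cayleyGraph.dist (x, y, z) (x, y + i, z + i * x) +
            cayleyGraph.dist (x, y + i, z + i * x) (x, y + (i + 1), z + (i + 1) * x) :=
          cayleyGraph_connected.dist_triangle
      _ ≤ (i : ℤ).natAbs + 1 :=
          add_le_add ih (SimpleGraph.dist_eq_one_iff_adj.mpr hadj).le
      _ = ((i : ℤ) + 1).natAbs := by omega
  | pred i ih =>
    have hadj : cayleyGraph.Adj (x, y + (-(i : ℤ) - 1), z + (-(i : ℤ) - 1) * x)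
        (x, y + -(i : ℤ), z + -(i : ℤ) * x) :=
      cayleyGraph_adj_mk_mulB (by ring) (by ring)
    calc cayleyGraph.dist (x, y, z) (x, y + (-(i : ℤ) - 1), z + (-(i : ℤ) - 1) * x)
        ≤ cayleyGraph.dist (x, y, z) (x, y + -(i : ℤ), z + -(i : ℤ) * x) +
            cayleyGraph.dist (x, y + -(i : ℤ), z + -(i : ℤ) * x)
              (x, y + (-(i : ℤ) - 1), z + (-(i : ℤ) - 1) * x) :=
          cayleyGraph_connected.dist_triangle
      _ ≤ (-(i : ℤ)).natAbs + 1 :=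
          add_le_add ih (SimpleGraph.dist_eq_one_iff_adj.mpr hadj.symm).le
      _ = (-(i : ℤ) - 1).natAbs := by omega

/-- `d_W(1, cᵗ) ≤ 2|t| + 2` for the central element `cᵗ = (0, 0, t)`: the walk `a bᵗ a⁻¹ b⁻ᵗ`
(`t ≥ 0`), resp. `bˢ a b⁻ˢ a⁻¹` (`t = -s ≤ 0`). [cite: CheegerKleinerNaor2011, §1.1] -/
theorem dist_zero_center_le (t : ℤ) :
    cayleyGraph.dist (0, 0, 0) (0, 0, t) ≤ 2 * t.natAbs + 2 := by
  have tri := @SimpleGraph.Connected.dist_triangle _ cayleyGraph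
  obtain ⟨n, rfl | rfl⟩ := Int.eq_nat_or_neg t
  · -- `a bⁿ a⁻¹ b⁻ⁿ`: (0,0,0) → (1,0,0) → (1,n,n) → (0,n,n) → (0,0,n)
    have d1 : cayleyGraph.dist (0, 0, 0) (1, 0, 0) ≤ 1 := dist_zero_genA.le
    have d2 : cayleyGraph.dist (1, 0, 0) (1, (n : ℤ), (n : ℤ)) ≤ n := by
      have h := dist_mulB_le 1 0 0 n
      rw [zero_add, mul_one, zero_add] at h
      simpa using h
    have d3 : cayleyGraph.dist (1, (n : ℤ), (n : ℤ)) (0, (n : ℤ), (n : ℤ)) ≤ 1 := by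
      have h := dist_mulA_le 1 n n (-1)
      simpa using h
    have d4 : cayleyGraph.dist (0, (n : ℤ), (n : ℤ)) (0, 0, (n : ℤ)) ≤ n := by
      have h := dist_mulB_le 0 n n (-n)
      simpa using h
    calc cayleyGraph.dist (0, 0, 0) (0, 0, (n : ℤ))
        ≤ cayleyGraph.dist (0, 0, 0) (0, (n : ℤ), (n : ℤ)) +
            cayleyGraph.dist (0, (n : ℤ), (n : ℤ)) (0, 0, (n : ℤ)) := tri cayleyGraph_connected
      _ ≤ (cayleyGraph.dist (0, 0, 0) (1, (n : ℤ), (n : ℤ)) +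
            cayleyGraph.dist (1, (n : ℤ), (n : ℤ)) (0, (n : ℤ), (n : ℤ))) + n :=
          add_le_add (tri cayleyGraph_connected) d4
      _ ≤ ((cayleyGraph.dist (0, 0, 0) (1, 0, 0) +
            cayleyGraph.dist (1, 0, 0) (1, (n : ℤ), (n : ℤ))) + 1) + n :=
          add_le_add (add_le_add (tri cayleyGraph_connected) d3) le_rfl
      _ ≤ ((1 + n) + 1) + n := by gcongr
      _ = 2 * (n : ℤ).natAbs + 2 := by simp; ring
  · -- `bⁿ a b⁻ⁿ a⁻¹`: (0,0,0) → (0,n,0) → (1,n,0) → (1,0,-n) → (0,0,-n)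
    have d1 : cayleyGraph.dist (0, 0, 0) (0, (n : ℤ), 0) ≤ n := by
      have h := dist_mulB_le 0 0 0 n
      simpa using h
    have d2 : cayleyGraph.dist (0, (n : ℤ), 0) (1, (n : ℤ), 0) ≤ 1 := by
      have h := dist_mulA_le 0 n 0 1
      simpa using h
    have d3 : cayleyGraph.dist (1, (n : ℤ), 0) (1, 0, -(n : ℤ)) ≤ n := by
      have h := dist_mulB_le 1 n 0 (-n)
      simpa using h
    have d4 : cayleyGraph.dist (1, 0, -(n : ℤ)) (0, 0, -(n : ℤ)) ≤ 1 := by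
      have h := dist_mulA_le 1 0 (-n) (-1)
      simpa using h
    calc cayleyGraph.dist (0, 0, 0) (0, 0, -(n : ℤ))
        ≤ cayleyGraph.dist (0, 0, 0) (1, 0, -(n : ℤ)) +
            cayleyGraph.dist (1, 0, -(n : ℤ)) (0, 0, -(n : ℤ)) := tri cayleyGraph_connected
      _ ≤ (cayleyGraph.dist (0, 0, 0) (1, (n : ℤ), 0) +
            cayleyGraph.dist (1, (n : ℤ), 0) (1, 0, -(n : ℤ))) + 1 :=
          add_le_add (tri cayleyGraph_connected) d4
      _ ≤ ((cayleyGraph.dist (0, 0, 0) (0, (n : ℤ), 0) +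
            cayleyGraph.dist (0, (n : ℤ), 0) (1, (n : ℤ), 0)) + n) + 1 :=
          add_le_add (add_le_add (tri cayleyGraph_connected) d3) le_rfl
      _ ≤ ((n + 1) + n) + 1 := by gcongr
      _ = 2 * (-(n : ℤ)).natAbs + 2 := by simp; ring

/-- `d_W(1, c^{qn}) ≤ 2n + 2|q|`: the walk `aⁿ b^q a⁻ⁿ b⁻^q` reaches `(0, 0, qn)`.
[cite: CheegerKleinerNaor2011, §1.1] -/
theorem dist_zero_center_mul_le (q : ℤ) (n : ℕ) :
    cayleyGraph.dist (0, 0, 0) (0, 0, q * n) ≤ 2 * n + 2 * q.natAbs := by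
  have tri := @SimpleGraph.Connected.dist_triangle _ cayleyGraph
  -- (0,0,0) → (n,0,0) → (n,q,qn) → (0,q,qn) → (0,0,qn)
  have d1 : cayleyGraph.dist (0, 0, 0) ((n : ℤ), 0, 0) ≤ n := by
    have h := dist_mulA_le 0 0 0 n
    simpa using h
  have d2 : cayleyGraph.dist ((n : ℤ), 0, 0) ((n : ℤ), q, q * n) ≤ q.natAbs := by
    have h := dist_mulB_le n 0 0 q
    simpa using h
  have d3 : cayleyGraph.dist ((n : ℤ), q, q * n) (0, q, q * n) ≤ n := by
    have h := dist_mulA_le n q (q * n) (-n)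
    simpa using h
  have d4 : cayleyGraph.dist (0, q, q * n) (0, 0, q * n) ≤ q.natAbs := by
    have h := dist_mulB_le 0 q (q * n) (-q)
    simpa using h
  calc cayleyGraph.dist (0, 0, 0) (0, 0, q * n)
      ≤ cayleyGraph.dist (0, 0, 0) (0, q, q * n) +
          cayleyGraph.dist (0, q, q * n) (0, 0, q * n) := tri cayleyGraph_connected
    _ ≤ (cayleyGraph.dist (0, 0, 0) ((n : ℤ), q, q * n) +
          cayleyGraph.dist ((n : ℤ), q, q * n) (0, q, q * n)) + q.natAbs :=
        add_le_add (tri cayleyGraph_connected) d4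
    _ ≤ ((cayleyGraph.dist (0, 0, 0) ((n : ℤ), 0, 0) +
          cayleyGraph.dist ((n : ℤ), 0, 0) ((n : ℤ), q, q * n)) + n) + q.natAbs :=
        add_le_add (add_le_add (tri cayleyGraph_connected) d3) le_rfl
    _ ≤ ((n + q.natAbs) + n) + q.natAbs := by gcongr
    _ = 2 * n + 2 * q.natAbs := by ring

/-- `d_W(1, cʷ) ≤ 8n` whenever `|w| ≤ 2n²` (`n ≥ 1`): write `w = qn + t` with `0 ≤ t < n`,
`|q| ≤ 2n`, and concatenate the walks for `c^{qn}` and `cᵗ`. [cite: CheegerKleinerNaor2011, §1.1] -/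
theorem dist_zero_center_le_of_sq {n : ℕ} (hn : 1 ≤ n) {w : ℤ} (hw : |w| ≤ 2 * (n : ℤ) ^ 2) :
    cayleyGraph.dist (0, 0, 0) (0, 0, w) ≤ 8 * n := by
  have hn0 : (0 : ℤ) < n := by exact_mod_cast hn
  set q : ℤ := w / n with hq
  set t : ℤ := w % n with ht
  have hqt : (n : ℤ) * q + t = w := Int.mul_ediv_add_emod w n
  have ht0 : 0 ≤ t := Int.emod_nonneg _ hn0.ne'
  have htn : t < n := Int.emod_lt_of_pos _ hn0
  rw [abs_le] at hw
  have hq1 : q ≤ 2 * n := by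
    by_contra hcon
    rw [not_le] at hcon
    nlinarith
  have hq2 : -(2 * (n : ℤ)) ≤ q := by
    by_contra hcon
    rw [not_le] at hcon
    nlinarith
  have hqabs : q.natAbs ≤ 2 * n := by
    have : |q| ≤ 2 * (n : ℤ) := abs_le.mpr ⟨hq2, hq1⟩
    zify
    simpa using this
  have htabs : t.natAbs + 1 ≤ n := by
    zify
    rw [abs_of_nonneg ht0]
    omega
  -- (0,0,0) → (0,0,qn) → (0,0,qn+t) = (0,0,w), the second leg by left-invariance
  have d1 : cayleyGraph.dist (0, 0, 0) (0, 0, q * n) ≤ 2 * n + 2 * q.natAbs :=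
    dist_zero_center_mul_le q n
  have d2 : cayleyGraph.dist (0, 0, q * n) (0, 0, w) ≤ 2 * t.natAbs + 2 := by
    have h := dist_heisMul_left (0, 0, q * n) (0, 0, 0) (0, 0, t)
    simp only [heisMul, add_zero, mul_zero] at h
    rw [show q * n + t = w by rw [← hqt]; ring] at h
    rw [h]
    exact dist_zero_center_le t
  calc cayleyGraph.dist (0, 0, 0) (0, 0, w)
      ≤ cayleyGraph.dist (0, 0, 0) (0, 0, q * n) + cayleyGraph.dist (0, 0, q * n) (0, 0, w) :=
        cayleyGraph_connected.dist_triangle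
    _ ≤ (2 * n + 2 * q.natAbs) + (2 * t.natAbs + 2) := add_le_add d1 d2
    _ ≤ (2 * n + 2 * (2 * n)) + 2 * n := by omega
    _ = 8 * n := by ring

/-- **The box lies in a word ball (discrete ball–box comparison)**: if `|x| ≤ n`, `|y| ≤ n` and
`|z| ≤ n²` then `d_W(1, (x,y,z)) ≤ 10 n` (walk to `c^{z−xy}` in `≤ 8n` steps, then `aˣ`, then
`bʸ`). With `mem_wordBall_bounds` (`𝔅_r ⊆ B_r`) this gives `B_n ⊆ 𝔅_{10n}`, the two-sided comparison
of the word metric with the gauge `|x| + |y| + √|z|` that transports [CKN Cor. 1.2] between the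
boxes `{0,…,n}³` and metric balls. [cite: CheegerKleinerNaor2011, §1.1] -/
theorem dist_zero_le_of_box {n : ℕ} {g : ℤ × ℤ × ℤ} (h1 : |g.1| ≤ n) (h2 : |g.2.1| ≤ n)
    (h3 : |g.2.2| ≤ (n : ℤ) ^ 2) : cayleyGraph.dist (0, 0, 0) g ≤ 10 * n := by
  obtain ⟨x, y, z⟩ := g
  simp only at h1 h2 h3
  rcases Nat.eq_zero_or_pos n with rfl | hn
  · -- `n = 0`: `g = 1`
    simp only [Nat.cast_zero, abs_nonpos_iff] at h1 h2
    have hz : z = 0 := by simpa using h3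
    subst h1 h2 hz
    simp
  -- `w = z - xy` has `|w| ≤ 2n²`
  have hw : |z - x * y| ≤ 2 * (n : ℤ) ^ 2 := by
    have hxy : |x * y| ≤ (n : ℤ) * n := by
      rw [abs_mul]
      exact mul_le_mul h1 h2 (abs_nonneg _) (by positivity)
    calc |z - x * y| ≤ |z| + |x * y| := abs_sub _ _
      _ ≤ (n : ℤ) ^ 2 + n * n := add_le_add h3 hxy
      _ = 2 * (n : ℤ) ^ 2 := by ring
  have d1 : cayleyGraph.dist (0, 0, 0) (0, 0, z - x * y) ≤ 8 * n := dist_zero_center_le_of_sq hn hw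
  have d2 : cayleyGraph.dist (0, 0, z - x * y) (x, 0, z - x * y) ≤ x.natAbs := by
    have h := dist_mulA_le 0 0 (z - x * y) x
    simpa using h
  have d3 : cayleyGraph.dist (x, 0, z - x * y) (x, y, z) ≤ y.natAbs := by
    have h := dist_mulB_le x 0 (z - x * y) y
    rw [zero_add, show z - x * y + y * x = z by ring] at h
    exact h
  have hx : x.natAbs ≤ n := by zify; simpa using h1
  have hy : y.natAbs ≤ n := by zify; simpa using h2
  calc cayleyGraph.dist (0, 0, 0) (x, y, z)
      ≤ cayleyGraph.dist (0, 0, 0) (x, 0, z - x * y) +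
          cayleyGraph.dist (x, 0, z - x * y) (x, y, z) := cayleyGraph_connected.dist_triangle
    _ ≤ (cayleyGraph.dist (0, 0, 0) (0, 0, z - x * y) +
          cayleyGraph.dist (0, 0, z - x * y) (x, 0, z - x * y)) + y.natAbs :=
        add_le_add cayleyGraph_connected.dist_triangle d3
    _ ≤ (8 * n + n) + n := by gcongr; exact d2.trans hx
    _ = 10 * n := by ring

/-- `B_n ⊆ 𝔅_{10n}`: the box `|x|,|y| ≤ n`, `|z| ≤ n²` lies in the word ball of radius `10 n`
(converse to `mem_wordBall_bounds`). [cite: CheegerKleinerNaor2011, §1.1] -/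
theorem box_subset_wordBall {n : ℕ} {g : ℤ × ℤ × ℤ} (h1 : |g.1| ≤ n) (h2 : |g.2.1| ≤ n)
    (h3 : |g.2.2| ≤ (n : ℤ) ^ 2) : g ∈ wordBall (10 * n) :=
  mem_wordBall_iff_dist_le.mpr (dist_zero_le_of_box h1 h2 h3)

/-! ### Two-point form of the word metric and quartic volume growth

Consequences of left-invariance and the ball–box comparison used when `n`-point statements
(`c₁(X_n) ≳ (log n)^δ`, CKN Remark 1.4: "`(ℍ(ℤ), d_T)` [is] doubling") are converted into
statements about radii: `d_W(g,h) = d_W(1, g⁻¹h)`, two-sided control of `d_W(g,h)` by the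
coordinates of `g⁻¹h = (h₁−g₁, h₂−g₂, (h₃−g₃) − g₁(h₂−g₂))`, finiteness of word balls and
`|𝔅_r| ≤ (2r+1)²(2r²+1)`, `(2n+1)²(2n²+1) ≤ |𝔅_{10n}|` (growth `≍ r⁴`). -/

/-- **Two-point form of the word metric**: `d_W(g, h) = d_W(1, g⁻¹h)` with
`g⁻¹h = (h₁−g₁, h₂−g₂, (h₃−g₃) − g₁(h₂−g₂))` (left-invariance, `dist_heisMul_left`).
[cite: CheegerKleinerNaor2011, §1.1] -/
theorem dist_eq_dist_zero (g h : ℤ × ℤ × ℤ) :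
    cayleyGraph.dist g h = cayleyGraph.dist (0, 0, 0)
      (h.1 - g.1, h.2.1 - g.2.1, (h.2.2 - g.2.2) - g.1 * (h.2.1 - g.2.1)) := by
  obtain ⟨x, y, z⟩ := g
  obtain ⟨x', y', z'⟩ := h
  have key := dist_heisMul_left (-x, -y, -z + x * y) (x, y, z) (x', y', z')
  have e1 : heisMul (-x, -y, -z + x * y) (x, y, z) = (0, 0, 0) := by
    simp only [heisMul, Prod.mk.injEq]
    exact ⟨by ring, by ring, by ring⟩
  have e2 : heisMul (-x, -y, -z + x * y) (x', y', z') =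
      (x' - x, y' - y, (z' - z) - x * (y' - y)) := by
    simp only [heisMul, Prod.mk.injEq]
    exact ⟨by ring, by ring, by ring⟩
  rw [e1, e2] at key
  exact key.symm

/-- **Lower control of `d_W(g,h)` by coordinates**: `|h₁−g₁| ≤ d_W(g,h)`, `|h₂−g₂| ≤ d_W(g,h)` and
`|(h₃−g₃) − g₁(h₂−g₂)| ≤ d_W(g,h)²` (two-point form of `mem_wordBall_bounds`).
[cite: CheegerKleinerNaor2011, §1.1] -/
theorem abs_sub_le_dist (g h : ℤ × ℤ × ℤ) :
    |h.1 - g.1| ≤ cayleyGraph.dist g h ∧ |h.2.1 - g.2.1| ≤ cayleyGraph.dist g h ∧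
      |(h.2.2 - g.2.2) - g.1 * (h.2.1 - g.2.1)| ≤ (cayleyGraph.dist g h : ℤ) ^ 2 := by
  rw [dist_eq_dist_zero]
  exact mem_wordBall_bounds (mem_wordBall_iff_dist_le.mpr le_rfl)

/-- **Upper control of `d_W(g,h)` by coordinates**: if `|h₁−g₁| ≤ n`, `|h₂−g₂| ≤ n` and
`|(h₃−g₃) − g₁(h₂−g₂)| ≤ n²` then `d_W(g,h) ≤ 10 n` (two-point form of `dist_zero_le_of_box`).
[cite: CheegerKleinerNaor2011, §1.1] -/
theorem dist_le_of_abs_sub_le {n : ℕ} {g h : ℤ × ℤ × ℤ} (h1 : |h.1 - g.1| ≤ n)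
    (h2 : |h.2.1 - g.2.1| ≤ n) (h3 : |(h.2.2 - g.2.2) - g.1 * (h.2.1 - g.2.1)| ≤ (n : ℤ) ^ 2) :
    cayleyGraph.dist g h ≤ 10 * n := by
  rw [dist_eq_dist_zero]
  exact dist_zero_le_of_box h1 h2 h3

/-- **Diameter of the box**: two points of `B_n = {|x|,|y| ≤ n, |z| ≤ n²}` are at word distance
`≤ 20 n` (their quotient lies in `B_{2n}`). [cite: CheegerKleinerNaor2011, §1.1] -/
theorem dist_le_of_box_of_box {n : ℕ} {g h : ℤ × ℤ × ℤ} (hg1 : |g.1| ≤ n) (hg2 : |g.2.1| ≤ n)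
    (hg3 : |g.2.2| ≤ (n : ℤ) ^ 2) (hh1 : |h.1| ≤ n) (hh2 : |h.2.1| ≤ n)
    (hh3 : |h.2.2| ≤ (n : ℤ) ^ 2) : cayleyGraph.dist g h ≤ 20 * n := by
  have h20 : 20 * n = 10 * (2 * n) := by ring
  rw [h20]
  rw [abs_le] at hg1 hg2 hg3 hh1 hh2 hh3
  refine dist_le_of_abs_sub_le (n := 2 * n) ?_ ?_ ?_
  · rw [abs_le]; push_cast; constructor <;> linarith
  · rw [abs_le]; push_cast; constructor <;> linarith
  · rw [abs_le]; push_cast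
    have hn : (0 : ℤ) ≤ n := by positivity
    constructor <;> nlinarith

/-- The word ball of radius `r` lies in the finite box `[-r,r]² × [-r²,r²]` (finset form of
`mem_wordBall_bounds`). [cite: CheegerKleinerNaor2011, §1.1] -/
theorem wordBall_subset_box (r : ℕ) :
    wordBall r ⊆ ↑(Finset.Icc (-(r : ℤ)) r ×ˢ (Finset.Icc (-(r : ℤ)) r ×ˢ
      Finset.Icc (-((r : ℤ) ^ 2)) ((r : ℤ) ^ 2))) := by
  intro g hg
  obtain ⟨h1, h2, h3⟩ := mem_wordBall_bounds hg
  rw [abs_le] at h1 h2 h3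
  simp only [Finset.coe_product, Finset.coe_Icc, Set.mem_prod, Set.mem_Icc]
  exact ⟨h1, h2, h3⟩

/-- The box `[-n,n]² × [-n²,n²]` lies in the word ball of radius `10 n` (finset form of
`box_subset_wordBall`). [cite: CheegerKleinerNaor2011, §1.1] -/
theorem box_subset_wordBall' (n : ℕ) :
    ↑(Finset.Icc (-(n : ℤ)) n ×ˢ (Finset.Icc (-(n : ℤ)) n ×ˢ
      Finset.Icc (-((n : ℤ) ^ 2)) ((n : ℤ) ^ 2))) ⊆ wordBall (10 * n) := by
  intro g hg
  simp only [Finset.coe_product, Finset.coe_Icc, Set.mem_prod, Set.mem_Icc] at hg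
  exact box_subset_wordBall (abs_le.mpr hg.1) (abs_le.mpr hg.2.1) (abs_le.mpr hg.2.2)

/-- The number of lattice points of the box `[-r,r]² × [-r²,r²]` is `(2r+1)²(2r²+1)`.
[folklore] -/
theorem card_box (r : ℕ) :
    (Finset.Icc (-(r : ℤ)) r ×ˢ (Finset.Icc (-(r : ℤ)) r ×ˢ
      Finset.Icc (-((r : ℤ) ^ 2)) ((r : ℤ) ^ 2))).card = (2 * r + 1) ^ 2 * (2 * r ^ 2 + 1) := by
  have hr : ((r : ℤ) + 1 - -(r : ℤ)).toNat = 2 * r + 1 := by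
    rw [show (r : ℤ) + 1 - -(r : ℤ) = ((2 * r + 1 : ℕ) : ℤ) by push_cast; ring, Int.toNat_natCast]
  have hr2 : ((r : ℤ) ^ 2 + 1 - -((r : ℤ) ^ 2)).toNat = 2 * r ^ 2 + 1 := by
    rw [show (r : ℤ) ^ 2 + 1 - -((r : ℤ) ^ 2) = ((2 * r ^ 2 + 1 : ℕ) : ℤ) by push_cast; ring,
      Int.toNat_natCast]
  rw [Finset.card_product, Finset.card_product, Int.card_Icc, Int.card_Icc, hr, hr2]
  ring

/-- **Word balls are finite.** [cite: NaorYoung2018, §1.2] -/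
theorem wordBall_finite (r : ℕ) : (wordBall r).Finite :=
  (Finset.finite_toSet _).subset (wordBall_subset_box r)

/-- **Quartic growth, upper bound**: `|𝔅_r| ≤ (2r+1)²(2r²+1)` (`𝔅_r ⊆ B_r`).
[cite: CheegerKleinerNaor2011, §1.1 Rem. 1.4] -/
theorem ncard_wordBall_le (r : ℕ) : (wordBall r).ncard ≤ (2 * r + 1) ^ 2 * (2 * r ^ 2 + 1) := by
  rw [← card_box r, ← Set.ncard_coe_finset]
  exact Set.ncard_le_ncard (wordBall_subset_box r) (Finset.finite_toSet _)

/-- **Quartic growth, lower bound**: `(2n+1)²(2n²+1) ≤ |𝔅_{10n}|` (`B_n ⊆ 𝔅_{10n}`); with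
`ncard_wordBall_le`, `|𝔅_r| ≍ r⁴` ("`(ℍ(ℤ), d_T)` is doubling").
[cite: CheegerKleinerNaor2011, §1.1 Rem. 1.4] -/
theorem le_ncard_wordBall (n : ℕ) : (2 * n + 1) ^ 2 * (2 * n ^ 2 + 1) ≤ (wordBall (10 * n)).ncard := by
  rw [← card_box n, ← Set.ncard_coe_finset]
  exact Set.ncard_le_ncard (box_subset_wordBall' n) (wordBall_finite _)

/-! ### The box form is equivalent to the named fact

`CheegerKleinerNaor2011_wordBall_l1Distortion.box` (in `HeisenbergL1.lean`) derives from the named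
fact the hypothesis inlined in the route `HeisenbergSparsestCut`; conversely, by `B_n ⊆ 𝔅_{10n}`
(`box_subset_wordBall`), that box form implies the named fact, so the route hypothesis is EXACTLY
as strong as [CKN Cor. 1.2] in the vendored form (up to the values of the universal constants). -/

namespace CheegerKleinerNaor2011_wordBall_l1Distortion

/-- **Converse of `CheegerKleinerNaor2011_wordBall_l1Distortion.box`**: the box form
(`∃ c > 0, ∀ n ≥ 2, …, c·(log n)^c ≤ D` for embeddings of the box `|x|,|y| ≤ n, |z| ≤ n²`, the
inlined hypothesis of `HeisenbergGivesLasserreGaps`) implies the named fact, with `δ = c` and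
`κ = min (c·2^{-c}) ((log 400)^{-c})`: for `r ≥ 400` restrict a ball embedding to the box of size
`n = ⌊r/10⌋` (`B_n ⊆ 𝔅_{10n} ⊆ 𝔅_r`, and `n² ≥ r` gives `log n ≥ ½ log r`); for `r < 400` use
`D ≥ 1` (the pair `1, a`). [cite: CheegerKleinerNaor2011, §1.1 Cor. 1.2] -/
theorem of_box
    (H : ∃ c : ℝ, 0 < c ∧ ∀ n : ℕ, 2 ≤ n → ∀ (N : ℕ) (f : ℤ × ℤ × ℤ → Fin N → ℝ) (s D : ℝ),
      0 < s →
      (∀ g h : ℤ × ℤ × ℤ, |g.1| ≤ n → |g.2.1| ≤ n → |g.2.2| ≤ n ^ 2 → |h.1| ≤ n → |h.2.1| ≤ n →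
        |h.2.2| ≤ n ^ 2 →
        s * ((SimpleGraph.fromRel fun a b : ℤ × ℤ × ℤ =>
              b = (a.1 + 1, a.2.1, a.2.2) ∨ b = (a.1, a.2.1 + 1, a.2.2 + a.1)).dist g h : ℝ) ≤
            ∑ k, |f g k - f h k| ∧
          ∑ k, |f g k - f h k| ≤
            D * s * ((SimpleGraph.fromRel fun a b : ℤ × ℤ × ℤ =>
              b = (a.1 + 1, a.2.1, a.2.2) ∨ b = (a.1, a.2.1 + 1, a.2.2 + a.1)).dist g h : ℝ)) →
      c * Real.log n ^ c ≤ D) :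
    CheegerKleinerNaor2011_wordBall_l1Distortion := by
  obtain ⟨c, hc, H⟩ := H
  have hκ1 : 0 < c * (1 / 2 : ℝ) ^ c := by positivity
  have hL : 0 < Real.log 400 := Real.log_pos (by norm_num)
  have hκ2 : 0 < (Real.log 400 ^ c)⁻¹ := by positivity
  refine ⟨c, hc, min (c * (1 / 2 : ℝ) ^ c) (Real.log 400 ^ c)⁻¹, lt_min hκ1 hκ2, ?_⟩
  intro r hr N f D hf
  have hlog0 : 0 ≤ Real.log r := Real.log_nonneg (by exact_mod_cast (by omega : 1 ≤ r))
  -- `D ≥ 1` from the pair `1 = (0,0,0)`, `a = (1,0,0)` at word distance `1`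
  have hD1 : 1 ≤ D := by
    obtain ⟨h1, h2⟩ := hf (0, 0, 0) (1, 0, 0) (zero_mem_wordBall r)
      (genA_mem_wordBall (by omega))
    rw [dist_zero_genA] at h1 h2
    simp only [Nat.cast_one, mul_one] at h1 h2
    linarith
  by_cases h400 : r < 400
  · -- small radii: `κ (log r)^c ≤ (log 400)^{-c} (log 400)^c = 1 ≤ D`
    have h1 : Real.log r ^ c ≤ Real.log 400 ^ c :=
      Real.rpow_le_rpow hlog0 (Real.log_le_log (by positivity) (by exact_mod_cast h400.le)) hc.le
    calc min (c * (1 / 2 : ℝ) ^ c) (Real.log 400 ^ c)⁻¹ * Real.log r ^ c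
        ≤ (Real.log 400 ^ c)⁻¹ * Real.log 400 ^ c :=
          mul_le_mul (min_le_right _ _) h1 (Real.rpow_nonneg hlog0 _) hκ2.le
      _ = 1 := inv_mul_cancel₀ (by positivity)
      _ ≤ D := hD1
  · -- large radii: restrict to the box of size `n = ⌊r/10⌋`
    rw [not_lt] at h400
    set n := r / 10 with hn
    have hn2 : 2 ≤ n := by omega
    have hn40 : 40 ≤ n := by omega
    have h10 : 10 * n ≤ r := by omega
    have hsq : r ≤ n * n := (by omega : r ≤ 40 * n).trans (Nat.mul_le_mul_right n hn40)
    have hbox : ∀ g h : ℤ × ℤ × ℤ, |g.1| ≤ n → |g.2.1| ≤ n → |g.2.2| ≤ n ^ 2 → |h.1| ≤ n →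
        |h.2.1| ≤ n → |h.2.2| ≤ n ^ 2 →
        1 * (cayleyGraph.dist g h : ℝ) ≤ ∑ k, |f g k - f h k| ∧
          ∑ k, |f g k - f h k| ≤ D * 1 * (cayleyGraph.dist g h : ℝ) := by
      intro g h hg1 hg2 hg3 hh1 hh2 hh3
      have hg : g ∈ wordBall r :=
        wordBall_mono h10 (box_subset_wordBall hg1 hg2 (by exact_mod_cast hg3))
      have hh : h ∈ wordBall r :=
        wordBall_mono h10 (box_subset_wordBall hh1 hh2 (by exact_mod_cast hh3))
      obtain ⟨h1, h2⟩ := hf g h hg hh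
      exact ⟨by simpa using h1, by simpa using h2⟩
    have hD : c * Real.log n ^ c ≤ D := H n hn2 N f 1 D one_pos hbox
    -- `½ log r ≤ log n` since `r ≤ n²`
    have hsqR : (r : ℝ) ≤ (n : ℝ) ^ 2 := by
      rw [sq]
      exact_mod_cast hsq
    have hlogn : (1 / 2 : ℝ) * Real.log r ≤ Real.log n := by
      have h1 : Real.log r ≤ Real.log ((n : ℝ) ^ 2) := Real.log_le_log (by positivity) hsqR
      rw [Real.log_pow] at h1
      push_cast at h1
      linarith
    calc min (c * (1 / 2 : ℝ) ^ c) (Real.log 400 ^ c)⁻¹ * Real.log r ^ c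
        ≤ (c * (1 / 2 : ℝ) ^ c) * Real.log r ^ c :=
          mul_le_mul_of_nonneg_right (min_le_left _ _) (Real.rpow_nonneg hlog0 _)
      _ = c * ((1 / 2 : ℝ) * Real.log r) ^ c := by
          rw [Real.mul_rpow (by norm_num) hlog0]
          ring
      _ ≤ c * Real.log n ^ c :=
          mul_le_mul_of_nonneg_left (Real.rpow_le_rpow (by positivity) hlogn hc.le) hc.le
      _ ≤ D := hD

/-- The named fact and its box form are equivalent. [cite: CheegerKleinerNaor2011, §1.1 Cor. 1.2] -/
theorem iff_box :
    CheegerKleinerNaor2011_wordBall_l1Distortion ↔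
      ∃ c : ℝ, 0 < c ∧ ∀ n : ℕ, 2 ≤ n → ∀ (N : ℕ) (f : ℤ × ℤ × ℤ → Fin N → ℝ) (s D : ℝ),
        0 < s →
        (∀ g h : ℤ × ℤ × ℤ, |g.1| ≤ n → |g.2.1| ≤ n → |g.2.2| ≤ n ^ 2 → |h.1| ≤ n →
          |h.2.1| ≤ n → |h.2.2| ≤ n ^ 2 →
          s * ((SimpleGraph.fromRel fun a b : ℤ × ℤ × ℤ =>
                b = (a.1 + 1, a.2.1, a.2.2) ∨ b = (a.1, a.2.1 + 1, a.2.2 + a.1)).dist g h : ℝ) ≤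
              ∑ k, |f g k - f h k| ∧
            ∑ k, |f g k - f h k| ≤
              D * s * ((SimpleGraph.fromRel fun a b : ℤ × ℤ × ℤ =>
                b = (a.1 + 1, a.2.1, a.2.2) ∨ b = (a.1, a.2.1 + 1, a.2.2 + a.1)).dist g h : ℝ)) →
        c * Real.log n ^ c ≤ D :=
  ⟨box, of_box⟩

end CheegerKleinerNaor2011_wordBall_l1Distortion

end Literature.Geometry.MetricEmbeddings

end
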